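import Mathlib
import Summits.Ventures.PercRepro2.Defs
import Summits.Ventures.PercRepro2.Independence
import Summits.Ventures.PercRepro2.Harris
import Summits.Ventures.PercRepro2.Graph
import Summits.Ventures.PercRepro2.Exploration
import Summits.Ventures.PercRepro2.Events
import Summits.Ventures.PercRepro2.FourFunctions
import Summits.Ventures.PercRepro2.Induced
import Summits.Ventures.PercRepro2.Frontier
import Summits.Ventures.PercRepro2.ObsIndependence
import Summits.Ventures.PercRepro2.BHK
import Summits.Ventures.PercRepro2.BHKEvents
import Summits.Ventures.PercRepro2.VdBKahn
import Summits.Ventures.PercRepro2.BHKAvoid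
import Summits.Ventures.PercRepro2.MultiSource
import Summits.Ventures.PercRepro2.SeedSet
import Summits.Ventures.PercRepro2.MultiSourceFun
import Summits.Ventures.PercRepro2.YBridge
import Summits.Ventures.PercRepro2.Yu1Functionals
import Summits.Ventures.PercRepro2.ZDelta
import Summits.Ventures.PercRepro2.ZExpand
import Summits.Ventures.PercRepro2.RGapShare
import Summits.Ventures.PercRepro2.ZhTwoCopy
import Summits.Ventures.PercRepro2.ExplorationTree

import Summits.Ventures.PercRepro2.ExplorationT

/-!
# The decision-tree sub-lemma SL1 implies (C1) (blind cell PercRepro2, typer-1; p1 g5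
`proofs/P1-L1TWOCOPY.md` §6, ask 2026-08-23T03:30:16Z)

On the vocabulary of `ExplorationTree` / `ExplorationT` (T-explorations `τ`, the pinned law of a
leaf, `Phi`, `leafA`, `leafB`, `leafQ`, `SL1`):

* **`C1_slack_eq`**: `D_o Δ_T − D [P(T, oS, bU) − T₂] = E[Φ · 1_T]` (the (C1)-slack by the
  heavy-first towers `tower_T_fb`, `tower_T_fo_bU`, `tower_T_bU`, `tower_T_fofb`);
* **`leaf_PA`**: on a T-leaf, `leafA ℓ · leafB ℓ ≤ E[Φ 1_Q ∣ ℓ] · leafQ ℓ` — positive association of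
  the two increasing functionals of the heavy cluster under the pinned law: `bhk_multi` with the
  seed set `S_ℓ` and the avoided vertex `a₁` (both functionals shifted by constants; the shifts
  cancel exactly);
* **`SL1_le_C1_slack`** and **`ZhTwoCopy_of_SL1`**: `0 ≤ SL1 τ → ZhTwoCopy` — the (C1) row follows
  from the sub-lemma `SL1 ≥ 0` for ANY T-exploration (p1's census: 0 / 1,187 labelled instances,
  13,308 T-leaves; hence `Z_h ≥ 0` by `ZhNonneg_of_ZhTwoCopy`).
-/

namespace Summit.Ventures.PercRepro2

open UnionCluster Yu1

namespace ExplorationTree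

section C1

variable {V : Type*} {E : Type*} [Fintype E] [DecidableEq E] [Fintype V] [DecidableEq V]
  {R : Type*} [Field R] [LinearOrder R] [IsStrictOrderedRing R]

omit [Fintype V] [DecidableEq V] [LinearOrder R] [IsStrictOrderedRing R] in
/-- Four-term linearity of `expect` in the shape used below. -/
lemma expect_comb4 (p : E → R) {g f₁ f₂ f₃ f₄ : Config E → R} {c₁ c₂ c₃ c₄ : R}
    (h : ∀ ω, g ω = c₁ * f₁ ω + c₂ * f₂ ω + c₃ * f₃ ω + c₄ * f₄ ω) :
    expect p g = c₁ * expect p f₁ + c₂ * expect p f₂ + c₃ * expect p f₃ + c₄ * expect p f₄ := by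
  simp only [expect]
  have h' : ∀ ω, weight p ω * g ω = c₁ * (weight p ω * f₁ ω) + c₂ * (weight p ω * f₂ ω) +
      c₃ * (weight p ω * f₃ ω) + c₄ * (weight p ω * f₄ ω) := by
    intro ω
    rw [h ω]
    ring
  simp only [h', Finset.sum_add_distrib, ← Finset.mul_sum]

omit [Fintype E] [DecidableEq E] [Fintype V] [DecidableEq V] [LinearOrder R]
  [IsStrictOrderedRing R] in
/-- `1_T = 1_{a₃ ∈ C₂} · 1_Q` pointwise. -/
lemma T_indicator_eq (ends : E → Sym2 V) (a₁ a₂ a₃ : V) (ω : Config E) :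
    (TEvent ends a₁ a₂ a₃).indicator (1 : Config E → R) ω =
      ({W : Set V | a₃ ∈ W}).indicator 1 (cluster ends ω a₂) *
        (avoidAll ends a₂ {a₁}).indicator 1 ω := by
  have e : TEvent ends a₁ a₂ a₃ = clusterInEvent ends a₂ {W | a₃ ∈ W} ∩ avoidAll ends a₂ {a₁} := by
    ext ω'
    simp only [TEvent, clusterInEvent, Set.mem_inter_iff, Set.mem_compl_iff, mem_connEvent,
      Set.mem_setOf_eq, mem_cluster, mem_avoidAll, Finset.mem_singleton, forall_eq]
    tauto
  rw [e, indicator_inter_one]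
  rfl

omit [DecidableEq V] [LinearOrder R] [IsStrictOrderedRing R] in
/-- Heavy-first tower: `E[f_b(C₂) 1_T] = P(T, b ∈ C₁)`. -/
lemma tower_T_fb (p : E → R) (ends : E → Sym2 V) (a₁ a₂ a₃ b : V) :
    expect p (fun ω => delClusterProb p ends a₁ {W | b ∈ W} (cluster ends ω a₂) *
        (TEvent ends a₁ a₂ a₃).indicator 1 ω) =
      prob p (connEvent ends a₁ b ∩ TEvent ends a₁ a₂ a₃) := by
  have e : connEvent ends a₁ b ∩ TEvent ends a₁ a₂ a₃ =
      clusterInEvent ends a₂ {W | a₃ ∈ W} ∩ clusterInEvent ends a₁ {W | b ∈ W} ∩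
        avoidAll ends a₂ {a₁} := by
    ext ω
    simp only [TEvent, clusterInEvent, Set.mem_inter_iff, Set.mem_compl_iff, mem_connEvent,
      Set.mem_setOf_eq, mem_cluster, mem_avoidAll, Finset.mem_singleton, forall_eq]
    tauto
  rw [e, prob_clusterIn_inter_avoid_eq_expect p ends a₂ a₁ (X := {a₁})
    (Finset.mem_singleton_self a₁)]
  congr 1
  funext ω
  rw [T_indicator_eq]
  ring

omit [DecidableEq V] [LinearOrder R] [IsStrictOrderedRing R] in
/-- Heavy-first tower: `E[f_o(C₂) 1_{b ∈ C₂} 1_T] = P(T, o ∈ C₁, b ∈ C₂)`. -/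
lemma tower_T_fo_bU (p : E → R) (ends : E → Sym2 V) (o a₁ a₂ a₃ b : V) :
    expect p (fun ω => delClusterProb p ends a₁ {W | o ∈ W} (cluster ends ω a₂) *
        ind b (cluster ends ω a₂) * (TEvent ends a₁ a₂ a₃).indicator 1 ω) =
      prob p (TEvent ends a₁ a₂ a₃ ∩ connEvent ends a₁ o ∩ connEvent ends a₂ b) := by
  have e : TEvent ends a₁ a₂ a₃ ∩ connEvent ends a₁ o ∩ connEvent ends a₂ b =
      clusterInEvent ends a₂ ({W | a₃ ∈ W} ∩ {W | b ∈ W}) ∩ clusterInEvent ends a₁ {W | o ∈ W} ∩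
        avoidAll ends a₂ {a₁} := by
    ext ω
    simp only [TEvent, clusterInEvent, Set.mem_inter_iff, Set.mem_compl_iff, mem_connEvent,
      Set.mem_setOf_eq, mem_cluster, mem_avoidAll, Finset.mem_singleton, forall_eq]
    tauto
  rw [e, prob_clusterIn_inter_avoid_eq_expect p ends a₂ a₁ (X := {a₁})
    (Finset.mem_singleton_self a₁)]
  congr 1
  funext ω
  rw [T_indicator_eq, Set.inter_indicator_one, Pi.mul_apply]
  unfold ind
  ring

omit [Fintype V] [DecidableEq V] [LinearOrder R] [IsStrictOrderedRing R] in
/-- `E[1_{b ∈ C₂} 1_T] = P(b ∈ C₂, T)`. -/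
lemma tower_T_bU (p : E → R) (ends : E → Sym2 V) (a₁ a₂ a₃ b : V) :
    expect p (fun ω => ind b (cluster ends ω a₂) * (TEvent ends a₁ a₂ a₃).indicator 1 ω) =
      prob p (connEvent ends a₂ b ∩ TEvent ends a₁ a₂ a₃) := by
  rw [prob_eq_expect_indicator]
  congr 1
  funext ω
  rw [indicator_inter_one]
  rfl

omit [Fintype V] [DecidableEq V] [LinearOrder R] [IsStrictOrderedRing R] in
/-- `E[f_o f_b 1_T] = T₂`. -/
lemma tower_T_fofb (p : E → R) (ends : E → Sym2 V) (o a₁ a₂ a₃ b : V) :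
    expect p (fun ω => delClusterProb p ends a₁ {W | o ∈ W} (cluster ends ω a₂) *
        delClusterProb p ends a₁ {W | b ∈ W} (cluster ends ω a₂) *
        (TEvent ends a₁ a₂ a₃).indicator 1 ω) =
      twoCopyT p ends o a₁ a₂ a₃ b := by
  unfold twoCopyT
  congr 1
  funext ω
  rw [T_indicator_eq]
  ring

omit [DecidableEq V] [LinearOrder R] [IsStrictOrderedRing R] in
/-- **The (C1)-slack is `E[Φ · 1_T]`**: `D_o Δ_T − D [P(T, oS, bU) − T₂] = E[Φ 1_T]`. -/
theorem C1_slack_eq (p : E → R) (ends : E → Sym2 V) (o a₁ a₂ a₃ b : V) :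
    (prob p (PDEvent ends a₁ a₂ a₃ ∩ connEvent ends a₁ o) +
          prob p (PDEvent ends a₁ a₂ a₃ ∩ connEvent ends a₂ o)) * deltaT p ends a₁ a₂ a₃ b -
        prob p (PDEvent ends a₁ a₂ a₃) *
          (prob p (TEvent ends a₁ a₂ a₃ ∩ connEvent ends a₁ o ∩ connEvent ends a₂ b) -
            twoCopyT p ends o a₁ a₂ a₃ b) =
      expect p (fun ω => Phi p ends o a₁ a₂ a₃ b ω * (TEvent ends a₁ a₂ a₃).indicator 1 ω) := by
  have h := expect_comb4 p (g := fun ω => Phi p ends o a₁ a₂ a₃ b ω *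
      (TEvent ends a₁ a₂ a₃).indicator 1 ω)
    (f₁ := fun ω => ind b (cluster ends ω a₂) * (TEvent ends a₁ a₂ a₃).indicator 1 ω)
    (f₂ := fun ω => delClusterProb p ends a₁ {W | b ∈ W} (cluster ends ω a₂) *
      (TEvent ends a₁ a₂ a₃).indicator 1 ω)
    (f₃ := fun ω => delClusterProb p ends a₁ {W | o ∈ W} (cluster ends ω a₂) *
      ind b (cluster ends ω a₂) * (TEvent ends a₁ a₂ a₃).indicator 1 ω)
    (f₄ := fun ω => delClusterProb p ends a₁ {W | o ∈ W} (cluster ends ω a₂) *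
      delClusterProb p ends a₁ {W | b ∈ W} (cluster ends ω a₂) *
      (TEvent ends a₁ a₂ a₃).indicator 1 ω)
    (c₁ := prob p (PDEvent ends a₁ a₂ a₃ ∩ connEvent ends a₁ o) +
      prob p (PDEvent ends a₁ a₂ a₃ ∩ connEvent ends a₂ o))
    (c₂ := -(prob p (PDEvent ends a₁ a₂ a₃ ∩ connEvent ends a₁ o) +
      prob p (PDEvent ends a₁ a₂ a₃ ∩ connEvent ends a₂ o)))
    (c₃ := -prob p (PDEvent ends a₁ a₂ a₃)) (c₄ := prob p (PDEvent ends a₁ a₂ a₃))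
    (fun ω => by unfold Phi; ring)
  rw [h, tower_T_bU, tower_T_fb, tower_T_fo_bU, tower_T_fofb]
  unfold deltaT
  ring

end C1

/-! ## Positive association on a leaf and the sub-lemma -/

section LeafPA

variable {V : Type*} {E : Type*} [Fintype E] [DecidableEq E] [Fintype V] [DecidableEq V]
  {R : Type*} [Field R] [LinearOrder R] [IsStrictOrderedRing R]

omit [Fintype V] [DecidableEq V] [LinearOrder R] [IsStrictOrderedRing R] in
/-- Probabilities under the pinned law only see `ℓ.event`. -/
lemma prob_pin_congr (p : E → R) (ℓ : Partial E) {A B : Set (Config E)}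
    (h : ∀ ω ∈ ℓ.event, ω ∈ A ↔ ω ∈ B) : prob (pin p ℓ) A = prob (pin p ℓ) B := by
  rw [prob_eq_expect_indicator, prob_eq_expect_indicator]
  refine expect_pin_congr p ℓ fun ω hω => ?_
  by_cases hA : ω ∈ A
  · have hB : ω ∈ B := (h ω hω).1 hA
    rw [Set.indicator_of_mem hA, Set.indicator_of_mem hB]
  · have hB : ω ∉ B := fun hB => hA ((h ω hω).2 hB)
    rw [Set.indicator_of_notMem hA, Set.indicator_of_notMem hB]

/-- **Positive association on a T-leaf** (`bhk_multi` under the pinned law, seed set `S_ℓ`, avoided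
vertex `a₁`): `leafA ℓ · leafB ℓ ≤ E[Φ 1_Q ∣ ℓ] · leafQ ℓ`. -/
theorem leaf_PA (p : E → R) (hp : IsProbVec p) (ends : E → Sym2 V) (o a₁ a₂ a₃ b : V)
    (τ : TExploration ends a₁ a₂ a₃) (ℓ : Partial E) (hℓ : ℓ ∈ leaves τ.tree root)
    (hT : τ.isT ℓ = true) :
    leafA p ends o a₁ a₂ a₃ ℓ * leafB p ends a₁ a₂ b ℓ ≤
      expect (pin p ℓ) (fun ω => Phi p ends o a₁ a₂ a₃ b ω *
        (avoidAll ends a₂ {a₁}).indicator 1 ω) * leafQ p ends a₁ a₂ ℓ := by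
  classical
  set q := pin p ℓ with hq_def
  have hq : IsProbVec q := isProbVec_pin hp ℓ
  have hdet := τ.determined ℓ hℓ hT
  set S := τ.seed ℓ
  set D := prob p (PDEvent ends a₁ a₂ a₃)
  set Do := prob p (PDEvent ends a₁ a₂ a₃ ∩ connEvent ends a₁ o) +
    prob p (PDEvent ends a₁ a₂ a₃ ∩ connEvent ends a₂ o)
  have hD : 0 ≤ D := prob_nonneg hp _
  -- the shifted, nonnegative, monotone functionals
  let F₁ : Set V → R := fun W => Do - D * delClusterProb p ends a₁ {W' | o ∈ W'} W + D
  let F₂ : Set V → R := fun W => ind b W - delClusterProb p ends a₁ {W' | b ∈ W'} W + 1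
  have hF₁ : Monotone F₁ := by
    intro W W' hWW'
    have := delClusterProb_anti p hp ends a₁ (isUpperSet_mem_setOf o) hWW'
    simp only [F₁]
    nlinarith
  have hF₂ : Monotone F₂ := by
    intro W W' hWW'
    have h1 := delClusterProb_anti p hp ends a₁ (isUpperSet_mem_setOf b) hWW'
    have h2 := ind_mono (R := R) b hWW'
    simp only [F₂]
    linarith
  have hDo : 0 ≤ Do := add_nonneg (prob_nonneg hp _) (prob_nonneg hp _)
  have hF₁0 : ∀ W, 0 ≤ F₁ W := by
    intro W
    have := delClusterProb_le_one p hp ends a₁ {W' | o ∈ W'} W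
    simp only [F₁]
    nlinarith
  have hF₂0 : ∀ W, 0 ≤ F₂ W := by
    intro W
    have := delClusterProb_le_one p hp ends a₁ {W' | b ∈ W'} W
    have := ind_nonneg (R := R) b W
    simp only [F₂]
    linarith
  have hbhk := bhk_multi q hq ends S hF₁ hF₂ hF₁0 hF₂0 {a₁} {a₁}
  simp only [Finset.inter_self, Finset.union_self] at hbhk
  -- transport every term to the heavy cluster and `Q`
  have conv : ∀ G : Set V → R,
      expect q (fun ω => G (clusterSet ends ω S) * (avoidAllT ends S {a₁}).indicator 1 ω) =
        expect q (fun ω => G (cluster ends ω a₂) * (avoidAll ends a₂ {a₁}).indicator 1 ω) := by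
    intro G
    refine expect_pin_congr p ℓ fun ω hω => ?_
    rw [hdet ω hω]
    congr 1
    by_cases hA : ω ∈ avoidAllT ends S {a₁}
    · have hB : ω ∈ avoidAll ends a₂ {a₁} := (avoidAllT_iff_of_determined hdet hω).1 hA
      rw [Set.indicator_of_mem hA, Set.indicator_of_mem hB]
    · have hB : ω ∉ avoidAll ends a₂ {a₁} := fun hB =>
        hA ((avoidAllT_iff_of_determined hdet hω).2 hB)
      rw [Set.indicator_of_notMem hA, Set.indicator_of_notMem hB]
  have convP : prob q (avoidAllT ends S {a₁}) = prob q (avoidAll ends a₂ {a₁}) :=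
    prob_pin_congr p ℓ fun ω hω => avoidAllT_iff_of_determined hdet hω
  rw [conv F₁, conv F₂, conv (F₁ * F₂), convP] at hbhk
  -- expand the shifts
  set PQ := prob q (avoidAll ends a₂ {a₁})
  set A := leafA p ends o a₁ a₂ a₃ ℓ
  set B := leafB p ends a₁ a₂ b ℓ
  set C := expect q (fun ω => Phi p ends o a₁ a₂ a₃ b ω * (avoidAll ends a₂ {a₁}).indicator 1 ω)
  have hPQ : PQ = expect q (fun ω => (avoidAll ends a₂ {a₁}).indicator 1 ω) :=
    prob_eq_expect_indicator q _
  have e₁ : expect q (fun ω => F₁ (cluster ends ω a₂) * (avoidAll ends a₂ {a₁}).indicator 1 ω) =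
      A + D * PQ := by
    rw [hPQ]
    have := Lambda.expect_comb q (g := fun ω => F₁ (cluster ends ω a₂) *
        (avoidAll ends a₂ {a₁}).indicator 1 ω)
      (f₁ := fun ω => (Do - D * delClusterProb p ends a₁ {W' | o ∈ W'} (cluster ends ω a₂)) *
        (avoidAll ends a₂ {a₁}).indicator 1 ω)
      (f₂ := fun ω => (avoidAll ends a₂ {a₁}).indicator 1 ω) (c₁ := 1) (c₂ := D)
      (fun ω => by simp only [F₁]; ring)
    rw [this, one_mul]
    rfl
  have e₂ : expect q (fun ω => F₂ (cluster ends ω a₂) * (avoidAll ends a₂ {a₁}).indicator 1 ω) =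
      B + PQ := by
    rw [hPQ]
    have := Lambda.expect_comb q (g := fun ω => F₂ (cluster ends ω a₂) *
        (avoidAll ends a₂ {a₁}).indicator 1 ω)
      (f₁ := fun ω => (ind b (cluster ends ω a₂) -
        delClusterProb p ends a₁ {W' | b ∈ W'} (cluster ends ω a₂)) *
        (avoidAll ends a₂ {a₁}).indicator 1 ω)
      (f₂ := fun ω => (avoidAll ends a₂ {a₁}).indicator 1 ω) (c₁ := 1) (c₂ := 1)
      (fun ω => by simp only [F₂]; ring)
    rw [this, one_mul, one_mul]
    rfl
  have e₃ : expect q (fun ω => (F₁ * F₂) (cluster ends ω a₂) *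
      (avoidAll ends a₂ {a₁}).indicator 1 ω) = C + A + D * B + D * PQ := by
    rw [hPQ]
    have := expect_comb4 q (g := fun ω => (F₁ * F₂) (cluster ends ω a₂) *
        (avoidAll ends a₂ {a₁}).indicator 1 ω)
      (f₁ := fun ω => Phi p ends o a₁ a₂ a₃ b ω * (avoidAll ends a₂ {a₁}).indicator 1 ω)
      (f₂ := fun ω => (Do - D * delClusterProb p ends a₁ {W' | o ∈ W'} (cluster ends ω a₂)) *
        (avoidAll ends a₂ {a₁}).indicator 1 ω)
      (f₃ := fun ω => (ind b (cluster ends ω a₂) -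
        delClusterProb p ends a₁ {W' | b ∈ W'} (cluster ends ω a₂)) *
        (avoidAll ends a₂ {a₁}).indicator 1 ω)
      (f₄ := fun ω => (avoidAll ends a₂ {a₁}).indicator 1 ω)
      (c₁ := 1) (c₂ := 1) (c₃ := D) (c₄ := D)
      (fun ω => by simp only [F₁, F₂, Pi.mul_apply, Phi]; ring)
    rw [this, one_mul, one_mul]
    rfl
  rw [e₁, e₂, e₃] at hbhk
  -- `(A + D PQ)(B + PQ) ≤ (C + A + D B + D PQ) PQ` is `A B ≤ C PQ`
  have : leafQ p ends a₁ a₂ ℓ = PQ := rfl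
  rw [this]
  nlinarith [hbhk]

/-- **`SL1 ≤ (C1)-slack`**: for every T-exploration,
`Σ_{T-leaves} P(ℓ) leafA ℓ leafB ℓ / leafQ ℓ ≤ D_o Δ_T − D [P(T, oS, bU) − T₂]`. -/
theorem SL1_le_C1_slack (p : E → R) (hp : IsProbVec p) (ends : E → Sym2 V) (o a₁ a₂ a₃ b : V)
    (τ : TExploration ends a₁ a₂ a₃) :
    SL1 p o b τ ≤
      (prob p (PDEvent ends a₁ a₂ a₃ ∩ connEvent ends a₁ o) +
          prob p (PDEvent ends a₁ a₂ a₃ ∩ connEvent ends a₂ o)) * deltaT p ends a₁ a₂ a₃ b -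
        prob p (PDEvent ends a₁ a₂ a₃) *
          (prob p (TEvent ends a₁ a₂ a₃ ∩ connEvent ends a₁ o ∩ connEvent ends a₂ b) -
            twoCopyT p ends o a₁ a₂ a₃ b) := by
  rw [C1_slack_eq, expect_T_eq_sum p τ]
  unfold SL1
  refine sum_map_le_sum_map _ _ _ fun ℓ hℓ => ?_
  have hℓ' : ℓ ∈ leaves τ.tree root := List.mem_of_mem_filter hℓ
  have hT : τ.isT ℓ = true := List.of_mem_filter hℓ
  have hPA := leaf_PA p hp ends o a₁ a₂ a₃ b τ ℓ hℓ' hT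
  have hP : 0 ≤ prob p ℓ.event := prob_nonneg hp _
  have hq : IsProbVec (pin p ℓ) := isProbVec_pin hp ℓ
  by_cases hQ : leafQ p ends a₁ a₂ ℓ = 0
  · -- a null `Q` on the leaf: both sides vanish
    rw [hQ, div_zero]
    have h0 : expect (pin p ℓ) (fun ω => Phi p ends o a₁ a₂ a₃ b ω *
        (avoidAll ends a₂ {a₁}).indicator 1 ω) = 0 :=
      expect_mul_indicator_eq_zero_of_null hq hQ _
    rw [h0, mul_zero]
  · have hQpos : 0 < leafQ p ends a₁ a₂ ℓ :=
      lt_of_le_of_ne (prob_nonneg hq _) (Ne.symm hQ)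
    rw [mul_assoc, mul_div_assoc]
    refine mul_le_mul_of_nonneg_left ?_ hP
    rw [div_le_iff₀ hQpos]
    exact hPA

/-- **(C1) from the sub-lemma**: `0 ≤ SL1 τ` for some T-exploration `τ` gives `ZhTwoCopy`
(hence `Z_h ≥ 0` by `ZhNonneg_of_ZhTwoCopy`). -/
theorem ZhTwoCopy_of_SL1 (p : E → R) (hp : IsProbVec p) (ends : E → Sym2 V) (o a₁ a₂ a₃ b : V)
    (τ : TExploration ends a₁ a₂ a₃) (h : 0 ≤ SL1 p o b τ) :
    ZhTwoCopy p ends o a₁ a₂ a₃ b := by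
  unfold ZhTwoCopy
  have := SL1_le_C1_slack p hp ends o a₁ a₂ a₃ b τ
  linarith

end LeafPA

end ExplorationTree

end Summit.Ventures.PercRepro2
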